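import Summits.MatrixMultiplication.MatrixMultiplication.Theorems.OctonionicLaserOctSpectralDominanceWeightLaser
import HarnessLib

/-!
# Route OctonionicLaser — crux `OctSpectralDominance` (stmt-MatrixMultiplication-7931): consequences of
# the weight-basis laser inequality — (i) ⟹ (ii), (i) ⟹ `ω = 2`, and `ω = 2 ⟹ (ii)`

From `octWeightLaser` (`3/2 + (3/4) log₂ F(⟨2,2,2⟩) ≤ log₂ F(t₈)` for every universal spectral point
`F` over `ℂ`) and Strassen duality (`strassen_duality_asymptoticRank_holds`, PROVED in tree):

* `octSpectralDominance_of_octAsymptoticRank` — **crux (i) implies crux (ii)**: if `R̃(t₈) ≤ 8` then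
  `2·F(⟨2,2,2⟩) ≤ F(t₈)` for every universal `F` (`F(t₈) ≤ R̃(t₈) ≤ 8` forces `F(⟨2,2,2⟩) ≤ 4`, and
  below `4` the laser inequality dominates `2·F(⟨2,2,2⟩)`); registered stub
  `stub_octDominanceOfAsymptoticRank` of the crux skeleton;
* `omega_le_two_of_octAsymptoticRank`, `matrixMultiplication_of_octAsymptoticRank` — **crux (i) ALONE
  closes the summit**: with `F(⟨2,2,2⟩) = R̃(⟨2,2,2⟩) = 2^ω` (duality, second clause) the laser
  inequality reads `3/2 + (3/4)ω ≤ log₂ R̃(t₈) ≤ 3`;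
* `octSpectralDominance_of_omega_le_two`, `octSpectralDominance_of_matrixMultiplication` — the summit
  implies crux (ii) (`F(⟨2,2,2⟩) ≤ R̃(⟨2,2,2⟩) = 2^ω = 4`).

So, for the route: the assembly `OctAsymptoticRank → OctSpectralDominance → MatrixMultiplication` can
drop its second hypothesis, and crux (ii) is equivalent to the summit GIVEN (i) and implied by the summit
outright.  Everything is proved; no definitions, no named facts.

## References

* [BurgisserClausenShokrollahi1997] BCS, *Algebraic Complexity Theory*, Thm. 15.41.
* [Strassen1988] V. Strassen, J. reine angew. Math. 384 (1988), Thm. 3.8 (duality).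
* [ChristandlVranaZuiddam2023] M. Christandl, P. Vrana, J. Zuiddam, J. AMS 36 (2023), Prop. 1.6, §1.2.
-/

noncomputable section

-- the tree's namespace `Summit.MatrixMultiplication.MatrixMultiplication.…` repeats a component by design
set_option linter.dupNamespace false

namespace Summit.MatrixMultiplication.MatrixMultiplication.Theorems

open Literature.Computability.AlgebraicComplexity
open Summit.MatrixMultiplication.MatrixMultiplication.Theses.OctonionicLaser (OctAsymptoticRank
  OctSpectralDominance)
open OctonionicLaser (octT)

/-! ## Real-variable core -/

/-- If `1 ≤ φ ≤ 4`, `0 ≤ T` and `3/2 + (3/4) log₂ φ ≤ log₂ T`, then `2 φ ≤ T`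
(`log₂ (2φ) = 1 + log₂ φ ≤ 3/2 + (3/4) log₂ φ` iff `log₂ φ ≤ 2`). [folklore] -/
theorem two_mul_le_of_weightLaser {φ T : ℝ} (hφ1 : 1 ≤ φ) (hφ4 : φ ≤ 4) (hT0 : 0 ≤ T)
    (h : (3/2 : ℝ) + 3/4 * Real.logb 2 φ ≤ Real.logb 2 T) : 2 * φ ≤ T := by
  have hφ0 : 0 < φ := one_pos.trans_le hφ1
  have hlogφ : 0 ≤ Real.logb 2 φ := Real.logb_nonneg one_lt_two hφ1
  have hT1 : 1 < T := by
    by_contra hle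
    push Not at hle
    have : Real.logb 2 T ≤ 0 := Real.logb_nonpos one_lt_two hT0 hle
    linarith
  have hTpos : 0 < T := one_pos.trans hT1
  have hlogφ2 : Real.logb 2 φ ≤ 2 := by
    calc Real.logb 2 φ ≤ Real.logb 2 4 := Real.logb_le_logb_of_le one_lt_two hφ0 hφ4
      _ = 2 := by
        rw [show (4 : ℝ) = 2 ^ (2 : ℕ) by norm_num, Real.logb_pow, Real.logb_self_eq_one one_lt_two]
        norm_num
  have hlog2φ : Real.logb 2 (2 * φ) = 1 + Real.logb 2 φ := by
    rw [Real.logb_mul two_ne_zero hφ0.ne', Real.logb_self_eq_one one_lt_two]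
  have key : Real.logb 2 (2 * φ) ≤ Real.logb 2 T := by rw [hlog2φ]; linarith
  exact (Real.logb_le_logb one_lt_two (by positivity) hTpos).1 key

/-- If `1 ≤ φ`, `0 ≤ T ≤ 8` and `3/2 + (3/4) log₂ φ ≤ log₂ T`, then `φ ≤ 4`. [folklore] -/
theorem le_four_of_weightLaser {φ T : ℝ} (hφ1 : 1 ≤ φ) (hT0 : 0 ≤ T) (hT8 : T ≤ 8)
    (h : (3/2 : ℝ) + 3/4 * Real.logb 2 φ ≤ Real.logb 2 T) : φ ≤ 4 := by
  have hφ0 : 0 < φ := one_pos.trans_le hφ1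
  have hlogφ : 0 ≤ Real.logb 2 φ := Real.logb_nonneg one_lt_two hφ1
  have hT1 : 1 < T := by
    by_contra hle
    push Not at hle
    have : Real.logb 2 T ≤ 0 := Real.logb_nonpos one_lt_two hT0 hle
    linarith
  have hTpos : 0 < T := one_pos.trans hT1
  have hlogT : Real.logb 2 T ≤ 3 := by
    calc Real.logb 2 T ≤ Real.logb 2 8 := Real.logb_le_logb_of_le one_lt_two hTpos hT8
      _ = 3 := by
        rw [show (8 : ℝ) = 2 ^ (3 : ℕ) by norm_num, Real.logb_pow, Real.logb_self_eq_one one_lt_two]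
        norm_num
  have hlogφ2 : Real.logb 2 φ ≤ 2 := by linarith
  have h4 : Real.logb 2 φ ≤ Real.logb 2 4 := by
    rw [show (4 : ℝ) = 2 ^ (2 : ℕ) by norm_num, Real.logb_pow, Real.logb_self_eq_one one_lt_two]
    norm_num; exact hlogφ2
  exact (Real.logb_le_logb one_lt_two hφ0 (by norm_num)).1 h4

/-- `1 ≤ F(⟨2,2,2⟩)` for a universal spectral point `F`. [folklore] -/
theorem one_le_spectral_matMulTensor_two {F : SpectralMap ℂ} (hF : IsUniversalSpectralPoint ℂ F) :
    1 ≤ F (matMulTensor ℂ 2 2 2) :=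
  one_le_spectral_of_ne_zero hF (matMulTensor_ne_zero two_pos two_pos two_pos)

/-! ## (i) ⟹ (ii) -/

/-- **Crux (i) implies crux (ii)**: `R̃(t₈) ≤ 8 ⟹ ∀ F` universal, `2·F(⟨2,2,2⟩) ≤ F(t₈)`.
`F(t₈) ≤ R̃(t₈) ≤ 8` (duality, first clause) and the weight-laser inequality give `F(⟨2,2,2⟩) ≤ 4`,
below which the laser inequality dominates. [cite: Strassen1988, Thm. 3.8] -/
theorem octSpectralDominance_of_octAsymptoticRank (hR : OctAsymptoticRank) : OctSpectralDominance := by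
  intro F hF
  have hW := octWeightLaser F hF
  have hφ1 := one_le_spectral_matMulTensor_two hF
  have hT0 : 0 ≤ F (octT ℂ) := hF.nonneg _
  have hT8 : F (octT ℂ) ≤ 8 := ((strassen_duality_asymptoticRank_holds ℂ (octT ℂ)).1 F hF).trans hR
  exact two_mul_le_of_weightLaser hφ1 (le_four_of_weightLaser hφ1 hT0 hT8 hW) hT0 hW

/-- **Stub `stub_octDominanceOfAsymptoticRank` of the crux skeleton of `OctSpectralDominance`
(stmt-MatrixMultiplication-7931, line `registered`)**: (i) ⟹ (ii) with the route's inline terms.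
[cite: Strassen1988, Thm. 3.8] -/
theorem stub_octDominanceOfAsymptoticRank :
    asymptoticRank (fun o p q : Fin 2 × Fin 2 × Fin 2 => (if o.1 = 0 ∧ p.1 = 0 ∧ q.1 = 0 then (Matrix.single p.2.1 p.2.2 (1:ℂ) * Matrix.single q.2.1 q.2.2 (1:ℂ)) o.2.1 o.2.2 else 0) - (if o.1 = 0 ∧ p.1 = 1 ∧ q.1 = 1 then ((Matrix.single q.2.1 q.2.2 (1:ℂ)).adjugate * Matrix.single p.2.1 p.2.2 (1:ℂ)) o.2.1 o.2.2 else 0) + (if o.1 = 1 ∧ p.1 = 0 ∧ q.1 = 1 then (Matrix.single q.2.1 q.2.2 (1:ℂ) * Matrix.single p.2.1 p.2.2 (1:ℂ)) o.2.1 o.2.2 else 0) + (if o.1 = 1 ∧ p.1 = 1 ∧ q.1 = 0 then (Matrix.single p.2.1 p.2.2 (1:ℂ) * (Matrix.single q.2.1 q.2.2 (1:ℂ)).adjugate) o.2.1 o.2.2 else 0)) ≤ 8 → ∀ F : SpectralMap ℂ, IsUniversalSpectralPoint ℂ F → 2 * F (matMulTensor ℂ 2 2 2) ≤ F (fun o p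 q : Fin 2 × Fin 2 × Fin 2 => (if o.1 = 0 ∧ p.1 = 0 ∧ q.1 = 0 then (Matrix.single p.2.1 p.2.2 (1:ℂ) * Matrix.single q.2.1 q.2.2 (1:ℂ)) o.2.1 o.2.2 else 0) - (if o.1 = 0 ∧ p.1 = 1 ∧ q.1 = 1 then ((Matrix.single q.2.1 q.2.2 (1:ℂ)).adjugate * Matrix.single p.2.1 p.2.2 (1:ℂ)) o.2.1 o.2.2 else 0) + (if o.1 = 1 ∧ p.1 = 0 ∧ q.1 = 1 then (Matrix.single q.2.1 q.2.2 (1:ℂ) * Matrix.single p.2.1 p.2.2 (1:ℂ)) o.2.1 o.2.2 else 0) + (if o.1 = 1 ∧ p.1 = 1 ∧ q.1 = 0 then (Matrix.single p.2.1 p.2.2 (1:ℂ) * (Matrix.single q.2.1 q.2.2 (1:ℂ)).adjugate) o.2.1 o.2.2 else 0)) :=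
  octSpectralDominance_of_octAsymptoticRank

/-! ## (i) ⟹ `ω = 2` -/

/-- **Crux (i) alone bounds `ω`**: `R̃(t₈) ≤ 8 ⟹ ω(ℂ) ≤ 2`.  Take a universal spectral point `F`
with `F(⟨2,2,2⟩) = R̃(⟨2,2,2⟩) = 2^ω` (duality, second clause; `asymptoticRank_matMulTensor`); the
weight-laser inequality reads `3/2 + (3/4)·ω ≤ log₂ F(t₈) ≤ log₂ 8 = 3`. [cite: Strassen1988, Thm. 3.8] -/
theorem omega_le_two_of_octAsymptoticRank (hR : OctAsymptoticRank) : omega ℂ ≤ 2 := by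
  obtain ⟨F, hF, hFeq⟩ := (strassen_duality_asymptoticRank_holds ℂ (matMulTensor ℂ 2 2 2)).2
  have hW := octWeightLaser F hF
  have hφ1 := one_le_spectral_matMulTensor_two hF
  have hT0 : 0 ≤ F (octT ℂ) := hF.nonneg _
  have hT8 : F (octT ℂ) ≤ 8 := ((strassen_duality_asymptoticRank_holds ℂ (octT ℂ)).1 F hF).trans hR
  have h4 := le_four_of_weightLaser hφ1 hT0 hT8 hW
  have h222 : asymptoticRank (matMulTensor ℂ 2 2 2) = (2 : ℝ) ^ omega ℂ := by
    exact_mod_cast asymptoticRank_matMulTensor ℂ 2 (by norm_num)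
  rw [hFeq, h222] at h4
  have h4' : (2 : ℝ) ^ omega ℂ ≤ (2 : ℝ) ^ (2 : ℝ) := by
    rw [show (2 : ℝ) ^ (2 : ℝ) = 4 by norm_num]; exact h4
  exact (Real.rpow_le_rpow_left_iff one_lt_two).1 h4'

/-- **Crux (i) alone closes the summit**: `R̃(t₈) ≤ 8 ⟹ ω(ℂ) = 2` (`MatrixMultiplication`).
[cite: Strassen1988, Thm. 3.8] -/
theorem matrixMultiplication_of_octAsymptoticRank (hR : OctAsymptoticRank) : _root_.MatrixMultiplication := by
  rw [MatrixMultiplication_iff]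
  exact le_antisymm (omega_le_two_of_octAsymptoticRank hR) (omega_two_le ℂ)

/-! ## `ω = 2 ⟹ (ii)` -/

/-- **`ω ≤ 2` implies crux (ii)**: `F(⟨2,2,2⟩) ≤ R̃(⟨2,2,2⟩) = 2^ω ≤ 4` for every universal `F`, below
which the weight-laser inequality dominates `2·F(⟨2,2,2⟩)`. [cite: Strassen1988, Thm. 3.8] -/
theorem octSpectralDominance_of_omega_le_two (hω : omega ℂ ≤ 2) : OctSpectralDominance := by
  intro F hF
  have hW := octWeightLaser F hF
  have hφ1 := one_le_spectral_matMulTensor_two hF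
  have hT0 : 0 ≤ F (octT ℂ) := hF.nonneg _
  have h222 : asymptoticRank (matMulTensor ℂ 2 2 2) = (2 : ℝ) ^ omega ℂ := by
    exact_mod_cast asymptoticRank_matMulTensor ℂ 2 (by norm_num)
  have hφ4 : F (matMulTensor ℂ 2 2 2) ≤ 4 := by
    calc F (matMulTensor ℂ 2 2 2) ≤ asymptoticRank (matMulTensor ℂ 2 2 2) :=
          (strassen_duality_asymptoticRank_holds ℂ _).1 F hF
      _ = (2 : ℝ) ^ omega ℂ := h222
      _ ≤ (2 : ℝ) ^ (2 : ℝ) := Real.rpow_le_rpow_of_exponent_le one_le_two hω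
      _ = 4 := by norm_num
  exact two_mul_le_of_weightLaser hφ1 hφ4 hT0 hW

/-- **The summit implies crux (ii).** [cite: Strassen1988, Thm. 3.8] -/
theorem octSpectralDominance_of_matrixMultiplication (h : _root_.MatrixMultiplication) : OctSpectralDominance :=
  octSpectralDominance_of_omega_le_two (le_of_eq (MatrixMultiplication_iff.1 h))


/-! ## The `ω`-form: `3/2 + (3/4)·ω ≤ log₂ R̃(t₈)` -/

/-- **Weight-laser bound on `ω`** (sharpens the route's `OctLaserBound` `ω ≤ log₂ R̃(t₈) − 0.918`):
`3/2 + (3/4)·ω(ℂ) ≤ log₂ R̃(t₈)`, i.e. `ω ≤ (4/3) log₂ R̃(t₈) − 2`; at `R̃(t₈) = 8` this is `ω = 2`, and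
`R̃(t₈) < 2^{3.2785} ≈ 9.70` would beat the 2025 record `2.371339`.  (Duality: a universal `F` with
`F(⟨2,2,2⟩) = R̃(⟨2,2,2⟩) = 2^ω`, `F(t₈) ≤ R̃(t₈)`.) [cite: Strassen1988, Thm. 3.8] -/
theorem octWeightLaserBound :
    (3/2 : ℝ) + 3/4 * omega ℂ ≤ Real.logb 2 (asymptoticRank (octT ℂ)) := by
  obtain ⟨F, hF, hFeq⟩ := (strassen_duality_asymptoticRank_holds ℂ (matMulTensor ℂ 2 2 2)).2
  have hW := octWeightLaser F hF
  have hφ1 := one_le_spectral_matMulTensor_two hF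
  have hT0 : 0 ≤ F (octT ℂ) := hF.nonneg _
  have hTR : F (octT ℂ) ≤ asymptoticRank (octT ℂ) := (strassen_duality_asymptoticRank_holds ℂ (octT ℂ)).1 F hF
  -- `F(t₈) > 1`
  have hlogφ : 0 ≤ Real.logb 2 (F (matMulTensor ℂ 2 2 2)) := Real.logb_nonneg one_lt_two hφ1
  have hT1 : 1 < F (octT ℂ) := by
    by_contra hle
    push Not at hle
    have : Real.logb 2 (F (octT ℂ)) ≤ 0 := Real.logb_nonpos one_lt_two hT0 hle
    linarith
  have hTpos : 0 < F (octT ℂ) := one_pos.trans hT1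
  have h222 : asymptoticRank (matMulTensor ℂ 2 2 2) = (2 : ℝ) ^ omega ℂ := by
    exact_mod_cast asymptoticRank_matMulTensor ℂ 2 (by norm_num)
  have hlogω : Real.logb 2 (F (matMulTensor ℂ 2 2 2)) = omega ℂ := by
    rw [hFeq, h222, Real.logb_rpow two_pos (by norm_num)]
  rw [hlogω] at hW
  exact hW.trans (Real.logb_le_logb_of_le one_lt_two hTpos hTR)

/-- `ω(ℂ) ≤ (4/3) log₂ r − 2` whenever `R̃(t₈) ≤ r`. [cite: Strassen1988, Thm. 3.8] -/
theorem omega_le_of_asymptoticRank_octT_le {r : ℝ} (hr : asymptoticRank (octT ℂ) ≤ r) :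
    omega ℂ ≤ 4/3 * Real.logb 2 r - 2 := by
  have h := octWeightLaserBound
  have hR1 : 1 < asymptoticRank (octT ℂ) := by
    -- `log₂ R̃(t₈) ≥ 3/2 + (3/4)ω ≥ 3` forces `R̃(t₈) > 1`
    by_contra hle
    push Not at hle
    have : Real.logb 2 (asymptoticRank (octT ℂ)) ≤ 0 :=
      Real.logb_nonpos one_lt_two (asymptoticRank_nonneg _) hle
    have hω := omega_two_le ℂ
    linarith
  have hlog : Real.logb 2 (asymptoticRank (octT ℂ)) ≤ Real.logb 2 r :=
    Real.logb_le_logb_of_le one_lt_two (one_pos.trans hR1) hr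
  linarith

end Summit.MatrixMultiplication.MatrixMultiplication.Theorems

end
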